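import Literature.Probability.LatticeModels.IsingDisorderFermion
import Literature.Probability.LatticeModels.PlaquetteWalkParity
import Literature.Probability.LatticeModels.SHolomorphicPrimitiveLaplacian
import HarnessLib

/-!
# The discrete primitive of the critical Kadanoff–Ceva fermion: cuts, gauge, Laplacians

Topic `Literature/Probability/LatticeModels`. Second brick of the lattice side of the programme
behind `Literature.Probability.LatticeModels.chi_onePoint_rho` (Chelkak–Hongler–Izyurov, Ann. of
Math. 181 (2015), "CHI15", Thm 1.3), continuing `IsingDisorderFermion.lean` (Kadanoff–Ceva corner
values `X_B(v, T) = ⟨μ_T σ_v σ_B⟩`, propagation identity, closedness of the flux form `X²`) with the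
lattice topology of `PlaquetteWalkParity.lean` (cuts of plaquette walks, mod-2 Jordan, hole-freeness).
It formalises, on a general discrete domain and in Kadanoff–Ceva variables (no global sign choice,
no contour sums), the lattice content of CHI15, Prop. 3.6 — the discrete primitive
`H = Re ∫ F²` of the spinor observable and its sub- and superharmonicity — following the local
computation of Smirnov 2010, Lemma 3.8 (Chelkak–Smirnov 2012, §3.3), and the branch-cut formalism of
Chelkak–Hongler–Izyurov 2021 ("CHI21"), §2.2:

* **Gauge equivalence of cuts** (`KCGaugeEquiv`: `T' = T ∆ ∂S`, `S ⊆ Λ`; CHI21 Lemma 2.4): an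
  equivalence relation compatible with toggling a bond, preserving the squared corner values
  (`KCGaugeEquiv.kcCorner_sq`); the critical **toggle identity**
  `X(u, T ∆ {e}) = √2 X(u, T) - ε X(u', T)`, `ε = +1` if the bond `e = {u,u'}` is added (CHI21
  Lemma 2.12), `ε = -1` if it is removed (`kcCorner_symmDiff_singleton_critical`).
* **Admissible systems of cuts** (`IsKCCuts`): across a bond touching `Λ` the cuts of its two
  plaquettes differ by the bond and a gauge move; across a bond with both endpoints frozen nothing
  is required (the flux form is closed there for any cuts) — this is how the one-cell fjords that
  CHI15 §2.1 exclude "to simplify the presentation" are handled. Closedness of the flux form and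
  existence of a primitive on hole-free plaquette sets (`IsKCCuts.isCornerClosedOn`,
  `IsKCCuts.exists_primitive`, by `exists_potential_of_holeFree`).
* **The Laplacian identities** (CHI15 Prop. 3.6 (iv) / Smirnov 2010 Lemma 3.8 in Kadanoff–Ceva
  form; algebraic core `kc_laplacian_core`: a signed 4-cycle with an odd number of negative edges has
  spectrum `±√2`): at a free site `u ∉ B` the white Laplacian `∑_k (X(u,T_{p_k})² - X(u+e_k,T_{p_k})²)`
  is `-(P² + Q²)` (`kc_white_laplacian`; the twist is the gauge move `∂{u}`, `X(u, T ∆ ∂{u}) = -X(u,T)`,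
  absent at background spins — CHI15 Remark 3.8); at a plaquette whose cut contains an odd number of
  its sides (a cut END; even at the source plaquette, where it fails — CHI15 Remark 3.8) the black
  Laplacian is `+(P² + Q²)` (`kc_black_laplacian`). For a primitive pair `(Hw, Hb)`
  (`IsKCPrimitive`): `Δ Hw ≤ 0` at free sites off `B`, `Δ Hb ≥ 0` at cut ends with four sides
  touching `Λ` (`IsKCPrimitive.latticeLaplacian_white_nonpos`, `…_black_nonneg`), and **`Hw`
  is locally constant along the frozen boundary** (`IsKCPrimitive.hw_eq_of_frozen`: the lattice
  form of the Dirichlet condition of CHI15 Prop. 3.6 (ii)), with the jump into a boundary plaquette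
  `Hb - Hw = ⟨μ_T σ_B⟩²` (`hb_sub_hw_of_frozen`).
* **Existence of admissible cut systems** (`exists_isKCCuts`): if the domain graph joins every free
  site to its four neighbours and is a subgraph of `ℤ²`, `Λ` is hole-free as a set of cells, and
  every plaquette of `P` is reachable from the source plaquette by a dual walk crossing only bonds
  touching `Λ`, then "bonds crossed an odd number of times by such a walk" is an admissible system,
  empty at the source and with odd side-parity elsewhere (the gauge sets are the odd sets of the
  closed dual walks, free by `oddFinset_subset`, with the right boundary by `edgeBoundary_oddFinset`).
* **Assembly** (`exists_kcCuts_primitive`): on the filled set of plaquettes touching `Λ`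
  (`touchPlaquettes`, `fillFinset`; filled plaquettes have frozen corners, `IsKCCuts.fill`) there are
  an admissible cut system from any source plaquette and a primitive pair, for every `β`, fixed
  boundary condition and background set; `latticeLaplacian_white_nonpos_of_mem` packages the
  superharmonicity at every free site off `B`.

Everything is proved; no named facts. NOT here: the normalisation of `Hw` on the outer boundary
component, the boundary modification of the Laplacian and the "negative inner normal derivative"
(CHI15 Prop. 3.6 (ii)–(iii); Chelkak–Smirnov 2012, §3.6), and all convergence statements.

## References

* D. Chelkak, C. Hongler, K. Izyurov, Ann. of Math. 181 (2015) 1087–1138 = arXiv:1202.2838: §2.1,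
  Prop. 2.4, Prop. 3.6, Remark 3.8 — `ChelkakHonglerIzyurovAnnals2015`.
* D. Chelkak, C. Hongler, K. Izyurov, arXiv:2103.10263 (2021): §2.2 (branch cuts), Lemma 2.4,
  Lemma 2.12 — `ChelkakHonglerIzyurov2021`.
* S. Smirnov, Ann. of Math. 172 (2010) 1435–1467: Lemma 3.6, Lemma 3.8, Appendix C — `Smirnov2010`.
* S. Friedli, Y. Velenik, *Statistical Mechanics of Lattice Systems* (2017), §3.1 (edge boundaries)
  — `FriedliVelenik2017`.
-/

noncomputable section

open MeasureTheory Finset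

namespace Literature.Probability.LatticeModels


section Toggle

/-- `T ∆ {e} = T ∪ {e}` for `e ∉ T`. [folklore] -/
theorem toggle_singleton_of_notMem {α : Type*} [DecidableEq α] {T : Finset α} {e : α} (he : e ∉ T) :
    symmDiff T {e} = insert e T := by
  ext x
  simp only [Finset.mem_symmDiff, mem_singleton, mem_insert]
  constructor
  · rintro (⟨hx, -⟩ | ⟨rfl, -⟩); · exact Or.inr hx
    · exact Or.inl rfl
  · rintro (rfl | hx); · exact Or.inr ⟨rfl, he⟩
    · exact Or.inl ⟨hx, fun h => he (h ▸ hx)⟩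

/-- `T ∆ {e} = T ∖ {e}` for `e ∈ T` (cf. `symmDiff_singleton_eq_erase` in `TreeGraphWickTuples.lean`).
[folklore] -/
theorem toggle_singleton_of_mem {α : Type*} [DecidableEq α] {T : Finset α} {e : α} (he : e ∈ T) :
    symmDiff T {e} = T.erase e := by
  ext x
  simp only [Finset.mem_symmDiff, mem_singleton, mem_erase]
  constructor
  · rintro (⟨hx, hxe⟩ | ⟨rfl, hx⟩); · exact ⟨hxe, hx⟩
    · exact absurd he hx
  · rintro ⟨hxe, hx⟩; exact Or.inl ⟨hx, hxe⟩

end Toggle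

section Gauge

variable {V : Type*} [DecidableEq V] (G : SimpleGraph V) [G.LocallyFinite]

/-- **Gauge equivalence of cuts**: `T'` is obtained from `T` by a gauge move, `T' = T ∆ ∂S` with
`S ⊆ Λ` (two branch cuts with the same endpoints, Chelkak–Hongler–Izyurov 2021, Lemma 2.4).
[cite: ChelkakHonglerIzyurov2021, Lemma 2.4] -/
def KCGaugeEquiv (Λ : Finset V) (T T' : Finset (Sym2 V)) : Prop :=
  ∃ S : Finset V, S ⊆ Λ ∧ T' = symmDiff T (edgeBoundary G S)

/-- Gauge equivalence is reflexive (`S = ∅`). [cite: ChelkakHonglerIzyurov2021, Lemma 2.4] -/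
theorem KCGaugeEquiv.refl (Λ : Finset V) (T : Finset (Sym2 V)) : KCGaugeEquiv G Λ T T :=
  ⟨∅, empty_subset _, by ext x; simp [Finset.mem_symmDiff, edgeBoundary, edgesTouching]⟩

/-- Gauge equivalence is symmetric (the same `S`). [cite: ChelkakHonglerIzyurov2021, Lemma 2.4] -/
theorem KCGaugeEquiv.symm {Λ : Finset V} {T T' : Finset (Sym2 V)} (h : KCGaugeEquiv G Λ T T') :
    KCGaugeEquiv G Λ T' T := by
  obtain ⟨S, hS, rfl⟩ := h
  exact ⟨S, hS, by rw [symmDiff_assoc, symmDiff_self, symmDiff_bot]⟩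

/-- Gauge equivalence is transitive (`S ∆ S'`, by `edgeBoundary_symmDiff`). [cite: ChelkakHonglerIzyurov2021, Lemma 2.4] -/
theorem KCGaugeEquiv.trans {Λ : Finset V} {T T' T'' : Finset (Sym2 V)} (h : KCGaugeEquiv G Λ T T')
    (h' : KCGaugeEquiv G Λ T' T'') : KCGaugeEquiv G Λ T T'' := by
  obtain ⟨S, hS, rfl⟩ := h
  obtain ⟨S', hS', rfl⟩ := h'
  refine ⟨symmDiff S S', fun x hx => ?_, ?_⟩
  · rcases (Finset.mem_symmDiff.1 hx) with ⟨h1, -⟩ | ⟨h1, -⟩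
    · exact hS h1
    · exact hS' h1
  · rw [edgeBoundary_symmDiff, symmDiff_assoc]

/-- Gauge moves commute with toggling a bond: `T ≈ T'` implies `T ∆ {e} ≈ T' ∆ {e}`. [cite: ChelkakHonglerIzyurov2021, Lemma 2.4] -/
theorem KCGaugeEquiv.symmDiff_singleton {Λ : Finset V} {T T' : Finset (Sym2 V)}
    (h : KCGaugeEquiv G Λ T T') (e : Sym2 V) :
    KCGaugeEquiv G Λ (symmDiff T {e}) (symmDiff T' {e}) := by
  obtain ⟨S, hS, rfl⟩ := h
  exact ⟨S, hS, symmDiff_right_comm _ _ _⟩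

/-- A gauge move keeps a cut inside the interacting bonds. [folklore] -/
theorem KCGaugeEquiv.subset {Λ : Finset V} {T T' : Finset (Sym2 V)} (h : KCGaugeEquiv G Λ T T')
    (hT : T ⊆ edgesTouching G Λ) : T' ⊆ edgesTouching G Λ := by
  obtain ⟨S, hS, rfl⟩ := h
  intro x hx
  rcases (Finset.mem_symmDiff.1 hx) with ⟨h1, -⟩ | ⟨h1, -⟩
  · exact hT h1
  · exact edgeBoundary_subset_edgesTouching G hS h1

/-- **Gauge-equivalent cuts have the same squared corner values** (the flux `|F|²` does not see
the sheet; Chelkak–Hongler–Izyurov 2015, Prop. 3.6). [cite: ChelkakHonglerIzyurovAnnals2015, Prop. 3.6] -/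
theorem KCGaugeEquiv.kcCorner_sq {Λ : Finset V} {T T' : Finset (Sym2 V)} (h : KCGaugeEquiv G Λ T T')
    (hT : T ⊆ edgesTouching G Λ) (β : ℝ) (η : SpinConfig V) (B : Finset V) (v : V) :
    kcCorner G Λ β (.fixed η) B T' v ^ 2 = kcCorner G Λ β (.fixed η) B T v ^ 2 := by
  obtain ⟨S, hS, rfl⟩ := h
  rw [kcCorner_symmDiff_edgeBoundary G hS β η B hT v, mul_pow, ← pow_mul, mul_comm _ 2, pow_mul,
    neg_one_sq, one_pow, one_mul]

/-- Toggling a bond of `edgesTouching` keeps a cut inside `edgesTouching`. [folklore] -/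
theorem symmDiff_singleton_subset_edgesTouching {Λ : Finset V} {T : Finset (Sym2 V)}
    (hT : T ⊆ edgesTouching G Λ) {e : Sym2 V} (he : e ∈ edgesTouching G Λ) :
    symmDiff T {e} ⊆ edgesTouching G Λ := by
  intro x hx
  rcases (Finset.mem_symmDiff.1 hx) with ⟨h1, -⟩ | ⟨h1, -⟩
  · exact hT h1
  · rw [mem_singleton.1 h1]; exact he

/-- The sign of toggling: `-1` if the bond is removed from the cut, `+1` if it is added. [folklore] -/
def kcSign (T : Finset (Sym2 V)) (e : Sym2 V) : ℝ := if e ∈ T then -1 else 1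

/-- `kcSign² = 1`. [folklore] -/
theorem kcSign_mul_self (T : Finset (Sym2 V)) (e : Sym2 V) : kcSign T e * kcSign T e = 1 := by
  unfold kcSign; split_ifs <;> norm_num

/-- **The critical propagation identity for toggling a bond** `e = {u, u'}` of the cut:
`X(u, T ∆ {e}) = √2 X(u, T) - ε X(u', T)`, `ε = +1` if `e ∉ T` (Chelkak–Hongler–Izyurov 2021,
Lemma 2.12), `ε = -1` if `e ∈ T` (the inverse of the same relation across `e`: the transfer matrix
`(√2, -1; -1, √2)` has inverse `(√2, 1; 1, √2)`). [cite: ChelkakHonglerIzyurov2021, Lemma 2.12] -/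
theorem kcCorner_symmDiff_singleton_critical (Λ : Finset V) (bc : BoundaryCondition V) (B : Finset V)
    (T : Finset (Sym2 V)) (u u' : V) :
    kcCorner G Λ criticalBetaTwo bc B (symmDiff T {s(u, u')}) u =
      Real.sqrt 2 * kcCorner G Λ criticalBetaTwo bc B T u -
        kcSign T s(u, u') * kcCorner G Λ criticalBetaTwo bc B T u' := by
  unfold kcSign
  by_cases he : s(u, u') ∈ T
  · rw [if_pos he, toggle_singleton_of_mem he]
    have hnot : s(u, u') ∉ T.erase s(u, u') := notMem_erase _ _
    have h1 := kcCorner_insert_critical G Λ bc B hnot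
    have h2 := kcCorner_insert_critical' G Λ bc B hnot
    rw [insert_erase he] at h1 h2
    rw [h1, h2]
    have hs : Real.sqrt 2 ^ 2 = 2 := Real.sq_sqrt zero_le_two
    linear_combination (-kcCorner G Λ criticalBetaTwo bc B (T.erase s(u, u')) u) * hs
  · rw [if_neg he, toggle_singleton_of_notMem he, one_mul]
    exact kcCorner_insert_critical G Λ bc B he

end Gauge

section Laplacian

variable (G₂ : SimpleGraph (Site 2)) [G₂.LocallyFinite]

/-- **Admissible systems of cuts** on a set `P` of plaquettes (the notion actually realised by
branch cuts inside a discrete domain, cf. `IsKCCutSystem`): every cut consists of bonds touching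
`Λ`, and across every bond interior to `P` EITHER the bond touches `Λ` and the two cuts differ by
it and a gauge move `∂S`, `S ⊆ Λ`, OR both endpoints of the bond are frozen (then no relation is
needed: the corner values at frozen sites do not depend on the site, `kcCorner_of_notMem`, and the
flux form is closed around the bond for any pair of cuts). The second alternative occurs at fjords
of one cell width, which Chelkak–Hongler–Izyurov 2015, §2.1 exclude "to simplify the presentation"
("all the edges joining vertices from `𝒱•` belong to `𝒱ᵐ`; this technical assumption can be
easily relaxed"). [cite: ChelkakHonglerIzyurovAnnals2015, §2.1; ChelkakHonglerIzyurov2021, §2.2] -/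
structure IsKCCuts (Λ : Finset (Site 2)) (cut : Site 2 → Finset (Sym2 (Site 2))) (P : Set (Site 2)) : Prop where
  /-- Cuts consist of bonds touching the volume. -/
  subset : ∀ p ∈ P, cut p ⊆ edgesTouching G₂ Λ
  /-- Across an interior bond: a gauge step, or a frozen bond. -/
  step : ∀ (u : Site 2) (k : Fin 4), faceAt u k ∈ P → faceAt u (k + 3) ∈ P →
    (cSrc (u, k) ∈ edgesTouching G₂ Λ ∧ ∃ S : Finset (Site 2), S ⊆ Λ ∧
        cut (faceAt u (k + 3)) = symmDiff (symmDiff (cut (faceAt u k)) {cSrc (u, k)}) (edgeBoundary G₂ S)) ∨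
      (u ∉ Λ ∧ u + cornerUnit k ∉ Λ)

/-- A cut system in the sense of `IsKCCutSystem` is admissible. [cite: ChelkakHonglerIzyurov2021, §2.2] -/
theorem IsKCCutSystem.isKCCuts {Λ : Finset (Site 2)} {cut : Site 2 → Finset (Sym2 (Site 2))} {P : Set (Site 2)}
    (h : IsKCCutSystem G₂ Λ cut P) : IsKCCuts G₂ Λ cut P :=
  ⟨h.subset, fun u k hk hk3 => Or.inl (h.step u k hk hk3)⟩

/-- **The flux form of an admissible system of cuts is closed** (fixed boundary condition, any
`β`): around a bond touching `Λ` this is `kcCorner_sq_cycle`; around a frozen bond all four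
corner values are `±⟨μ_T σ_B⟩` for the respective cuts and the cycle identity is trivial.
[cite: ChelkakHonglerIzyurovAnnals2015, Prop. 3.6; Smirnov2010, Lemma 3.6] -/
theorem IsKCCuts.isCornerClosedOn {Λ : Finset (Site 2)} (β : ℝ) (η : SpinConfig (Site 2))
    (B : Finset (Site 2)) {cut : Site 2 → Finset (Sym2 (Site 2))} {P : Set (Site 2)}
    (h : IsKCCuts G₂ Λ cut P) : IsCornerClosedOn (kcFlux G₂ Λ β (.fixed η) B cut) P := by
  intro u k hk hk3
  rcases h.step u k hk hk3 with ⟨he, S, hS, hcut⟩ | ⟨hu, hu'⟩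
  · have hc := kcCorner_sq_cycle G₂ hS β η B (h.subset _ hk) (u := u) (u' := u + cornerUnit k) he
    simp only [IsCornerClosedAt, kcFlux, cFace, faceAt_add_unit_succ, faceAt_add_unit_add_two, hcut, cSrc]
    exact hc
  · simp only [IsCornerClosedAt, kcFlux, cFace, faceAt_add_unit_succ, faceAt_add_unit_add_two]
    rw [kcCorner_of_notMem G₂ Λ β η B _ hu, kcCorner_of_notMem G₂ Λ β η B _ hu',
      kcCorner_of_notMem G₂ Λ β η B _ hu, kcCorner_of_notMem G₂ Λ β η B _ hu']
    have h1 : spinAt u η ^ 2 = 1 := spinAt_sq u η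
    have h2 : spinAt (u + cornerUnit k) η ^ 2 = 1 := spinAt_sq _ η
    simp only [mul_pow, h1, h2, one_mul]

/-- **Existence of the discrete primitive for an admissible system of cuts on a hole-free set of
plaquettes** (Chelkak–Hongler–Izyurov 2015, Prop. 3.6 (i); topology: `exists_potential_of_holeFree`).
[cite: ChelkakHonglerIzyurovAnnals2015, Prop. 3.6; Smirnov2010, Lemma 3.6] -/
theorem IsKCCuts.exists_primitive {Λ : Finset (Site 2)} (β : ℝ) (η : SpinConfig (Site 2)) (B : Finset (Site 2))
    {cut : Site 2 → Finset (Sym2 (Site 2))} {P : Finset (Site 2)} (hP : HoleFree (↑P : Set (Site 2)))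
    (h : IsKCCuts G₂ Λ cut ↑P) :
    ∃ Hw Hb : Site 2 → ℝ, ∀ q ∈ faceSetCorners (↑P : Set (Site 2)),
      Hb (cFace q) - Hw q.1 = kcFlux G₂ Λ β (.fixed η) B cut q :=
  exists_potential_of_holeFree _ P hP (h.isCornerClosedOn G₂ β η B)

/-- **The white (site) Laplacian of the Kadanoff–Ceva primitive is a negative sum of two squares.**
Let `u ∈ Λ` be a free site off the background spins (`u ∉ B`) whose four plaquettes carry cuts of a
cut system and whose four bonds are exactly its boundary edges in `G`. With `H` any primitive of the
flux form (`Hb(p) - Hw(v) = X_B(v, T_p)²`), the lattice Laplacian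
`∑_k (Hw(u + e_k) - Hw(u)) = ∑_k (X(u, T_{p_k})² - X(u + e_k, T_{p_k})²)` equals `-(P² + Q²)` — the
Kadanoff–Ceva form of Smirnov 2010, Lemma 3.8 (white squares: `ΔH = -|F(e₀) - F(e₂)|²`) /
Chelkak–Hongler–Izyurov 2015, Prop. 3.6 (subharmonicity of `H°` off the marked spins, in their sign
convention). The twist of the spinor around `u` enters as the gauge move `∂{u}`:
`X(u, T ∆ ∂{u}) = -X(u, T)`; at a background spin `u ∈ B` it is absent and the statement fails
(Chelkak–Hongler–Izyurov 2015, Remark 3.8). [cite: Smirnov2010, Lemma 3.8; ChelkakHonglerIzyurovAnnals2015, Prop. 3.6 and Remark 3.8] -/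
theorem kc_white_laplacian {Λ : Finset (Site 2)} (η : SpinConfig (Site 2)) {B : Finset (Site 2)}
    {cut : Site 2 → Finset (Sym2 (Site 2))} {P : Set (Site 2)} (h : IsKCCuts G₂ Λ cut P)
    {u : Site 2} (hu : u ∈ Λ) (huB : u ∉ B) (hP : ∀ k : Fin 4, faceAt u k ∈ P)
    (hbd : edgeBoundary G₂ {u} = Finset.univ.image fun k : Fin 4 => cSrc (u, k)) :
    ∃ P₁ Q₁ : ℝ, ∑ k : Fin 4, (kcFlux G₂ Λ criticalBetaTwo (.fixed η) B cut (u, k) -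
        kcFlux G₂ Λ criticalBetaTwo (.fixed η) B cut (u + cornerUnit k, k + 1)) = -(P₁ ^ 2 + Q₁ ^ 2) := by
  -- notation
  set X : Finset (Sym2 (Site 2)) → Site 2 → ℝ := fun T v => kcCorner G₂ Λ criticalBetaTwo (.fixed η) B T v
    with hX
  set e : Fin 4 → Sym2 (Site 2) := fun k => cSrc (u, k) with he
  set T : Fin 4 → Finset (Sym2 (Site 2)) := fun k => cut (faceAt u k) with hT
  -- the explicit chain of cuts around `u`: `U₀ = T₀`, `U₃ = U₀ ∆ e₀`, `U₂ = U₃ ∆ e₃`, `U₁ = U₂ ∆ e₂`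
  set U₀ := T 0 with hU₀
  set U₃ := symmDiff U₀ {e 0} with hU₃
  set U₂ := symmDiff U₃ {e 3} with hU₂
  set U₁ := symmDiff U₂ {e 2} with hU₁
  -- steps of the cut system around `u` (all four bonds touch `Λ` at `u`)
  have hstep : ∀ k : Fin 4, e k ∈ edgesTouching G₂ Λ ∧ KCGaugeEquiv G₂ Λ (symmDiff (T k) {e k}) (T (k + 3)) := by
    intro k
    rcases h.step u k (hP k) (hP (k + 3)) with ⟨hek, S, hS, hcut⟩ | ⟨hu', -⟩
    · exact ⟨hek, S, hS, hcut⟩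
    · exact absurd hu hu' 
  have hT₀sub : U₀ ⊆ edgesTouching G₂ Λ := h.subset _ (hP 0)
  have hU₃sub : U₃ ⊆ edgesTouching G₂ Λ := symmDiff_singleton_subset_edgesTouching G₂ hT₀sub (hstep 0).1
  have hU₂sub : U₂ ⊆ edgesTouching G₂ Λ := symmDiff_singleton_subset_edgesTouching G₂ hU₃sub (hstep 3).1
  have hU₁sub : U₁ ⊆ edgesTouching G₂ Λ := symmDiff_singleton_subset_edgesTouching G₂ hU₂sub (hstep 2).1
  -- `T₃ ≈ U₃`, `T₂ ≈ U₂`, `T₁ ≈ U₁`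
  have g₃ : KCGaugeEquiv G₂ Λ U₃ (T 3) := by
    have := (hstep 0).2; simpa using this
  have g₂ : KCGaugeEquiv G₂ Λ U₂ (T 2) := by
    have h32 : KCGaugeEquiv G₂ Λ (symmDiff (T 3) {e 3}) (T 2) := by
      have := (hstep 3).2; simpa using this
    exact ((g₃.symmDiff_singleton G₂ (e 3)).trans G₂ h32)
  have g₁ : KCGaugeEquiv G₂ Λ U₁ (T 1) := by
    have h21 : KCGaugeEquiv G₂ Λ (symmDiff (T 2) {e 2}) (T 1) := by
      have := (hstep 2).2; simpa using this
    exact ((g₂.symmDiff_singleton G₂ (e 2)).trans G₂ h21)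
  -- fluxes in terms of the chain
  have flux_in : ∀ k : Fin 4, kcFlux G₂ Λ criticalBetaTwo (.fixed η) B cut (u, k) = X (T k) u ^ 2 :=
    fun k => rfl
  have flux_out : ∀ k : Fin 4, kcFlux G₂ Λ criticalBetaTwo (.fixed η) B cut (u + cornerUnit k, k + 1) =
      X (T k) (u + cornerUnit k) ^ 2 := by
    intro k
    simp only [kcFlux, cFace, faceAt_add_unit_succ, hX, hT]
  rw [Fin.sum_univ_four]
  simp only [flux_in, flux_out]
  have s3u : X (T 3) u ^ 2 = X U₃ u ^ 2 := g₃.kcCorner_sq G₂ hU₃sub _ η B u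
  have s3w : X (T 3) (u + cornerUnit 3) ^ 2 = X U₃ (u + cornerUnit 3) ^ 2 :=
    g₃.kcCorner_sq G₂ hU₃sub _ η B _
  have s2u : X (T 2) u ^ 2 = X U₂ u ^ 2 := g₂.kcCorner_sq G₂ hU₂sub _ η B u
  have s2w : X (T 2) (u + cornerUnit 2) ^ 2 = X U₂ (u + cornerUnit 2) ^ 2 :=
    g₂.kcCorner_sq G₂ hU₂sub _ η B _
  have s1u : X (T 1) u ^ 2 = X U₁ u ^ 2 := g₁.kcCorner_sq G₂ hU₁sub _ η B u
  have s1w : X (T 1) (u + cornerUnit 1) ^ 2 = X U₁ (u + cornerUnit 1) ^ 2 :=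
    g₁.kcCorner_sq G₂ hU₁sub _ η B _
  -- the four exact propagation relations
  have r₀ : X U₃ u = Real.sqrt 2 * X U₀ u - kcSign U₀ (e 0) * X U₀ (u + cornerUnit 0) :=
    kcCorner_symmDiff_singleton_critical G₂ Λ _ B U₀ u (u + cornerUnit 0)
  have r₃ : X U₂ u = Real.sqrt 2 * X U₃ u - kcSign U₃ (e 3) * X U₃ (u + cornerUnit 3) :=
    kcCorner_symmDiff_singleton_critical G₂ Λ _ B U₃ u (u + cornerUnit 3)
  have r₂ : X U₁ u = Real.sqrt 2 * X U₂ u - kcSign U₂ (e 2) * X U₂ (u + cornerUnit 2) :=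
    kcCorner_symmDiff_singleton_critical G₂ Λ _ B U₂ u (u + cornerUnit 2)
  -- the closing relation: `U₁ ∆ e₁ = U₀ ∆ ∂{u}` and `X(u, U₀ ∆ ∂{u}) = -X(u, U₀)`
  have hdist : ∀ j k : Fin 4, e j = e k → j = k := by
    intro j k hjk
    simp only [he, cSrc, Sym2.eq_iff] at hjk
    rcases hjk with ⟨-, h2⟩ | ⟨h1, -⟩
    · exact cornerUnit_injective (add_left_cancel h2)
    · exfalso
      have h0 : cornerUnit k = 0 := by
        have := congrArg (fun z => z - u) h1
        simpa using this.symm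
      exact absurd h0 (by fin_cases k <;> decide)
  have hne : ∀ j k : Fin 4, j ≠ k → e j ≠ e k := fun j k hjk h => hjk (hdist j k h)
  have hchain : symmDiff (symmDiff (symmDiff ({e 0} : Finset (Sym2 (Site 2))) {e 3}) {e 2}) {e 1} =
      insert (e 1) (insert (e 2) (insert (e 3) {e 0})) := by
    rw [toggle_singleton_of_notMem (by simp [hne 3 0 (by decide)] : e 3 ∉ ({e 0} : Finset _)),
      toggle_singleton_of_notMem (by simp [hne 2 3 (by decide), hne 2 0 (by decide)] :
        e 2 ∉ (insert (e 3) {e 0} : Finset _)),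
      toggle_singleton_of_notMem (by simp [hne 1 2 (by decide), hne 1 3 (by decide), hne 1 0 (by decide)] :
        e 1 ∉ (insert (e 2) (insert (e 3) {e 0}) : Finset _))]
  have himg : (Finset.univ.image e) = insert (e 1) (insert (e 2) (insert (e 3) {e 0})) := by
    ext x
    simp only [mem_image, mem_univ, true_and, mem_insert, mem_singleton]
    constructor
    · rintro ⟨k, rfl⟩; fin_cases k <;> simp
    · rintro (rfl | rfl | rfl | rfl) <;> exact ⟨_, rfl⟩
  have hclose : symmDiff U₁ {e 1} = symmDiff U₀ (edgeBoundary G₂ {u}) := by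
    rw [hbd, himg, ← hchain, hU₁, hU₂, hU₃]
    simp only [symmDiff_assoc]
  have r₁ : -X U₀ u = Real.sqrt 2 * X U₁ u - kcSign U₁ (e 1) * X U₁ (u + cornerUnit 1) := by
    have h1 := kcCorner_symmDiff_singleton_critical G₂ Λ (.fixed η) B U₁ u (u + cornerUnit 1)
    have hsing : ({u} : Finset (Site 2)) ⊆ Λ := singleton_subset_iff.2 hu
    have h2 := kcCorner_symmDiff_edgeBoundary G₂ hsing criticalBetaTwo η B hT₀sub u
    have hcard : #(symmDiff B {u} ∩ {u}) = 1 := by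
      rw [card_eq_one]; refine ⟨u, ?_⟩
      ext x; simp only [mem_inter, Finset.mem_symmDiff, mem_singleton]
      constructor
      · rintro ⟨-, rfl⟩; rfl
      · rintro rfl; exact ⟨Or.inr ⟨rfl, huB⟩, rfl⟩
    rw [hcard, pow_one, neg_one_mul] at h2
    rw [← h2, ← hclose]
    exact h1
  -- the algebra: squares of the outer values from the relations (`kcSign² = 1`)
  have q₀ := kcSign_mul_self U₀ (e 0)
  have q₃ := kcSign_mul_self U₃ (e 3)
  have q₂ := kcSign_mul_self U₂ (e 2)
  have q₁ := kcSign_mul_self U₁ (e 1)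
  have b₀ : X U₀ (u + cornerUnit 0) ^ 2 = (Real.sqrt 2 * X U₀ u - X U₃ u) ^ 2 := by
    have hb : kcSign U₀ (e 0) * X U₀ (u + cornerUnit 0) = Real.sqrt 2 * X U₀ u - X U₃ u := by
      linear_combination r₀
    rw [← hb]; linear_combination (-(X U₀ (u + cornerUnit 0)) ^ 2) * q₀
  have b₃ : X U₃ (u + cornerUnit 3) ^ 2 = (Real.sqrt 2 * X U₃ u - X U₂ u) ^ 2 := by
    have hb : kcSign U₃ (e 3) * X U₃ (u + cornerUnit 3) = Real.sqrt 2 * X U₃ u - X U₂ u := by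
      linear_combination r₃
    rw [← hb]; linear_combination (-(X U₃ (u + cornerUnit 3)) ^ 2) * q₃
  have b₂ : X U₂ (u + cornerUnit 2) ^ 2 = (Real.sqrt 2 * X U₂ u - X U₁ u) ^ 2 := by
    have hb : kcSign U₂ (e 2) * X U₂ (u + cornerUnit 2) = Real.sqrt 2 * X U₂ u - X U₁ u := by
      linear_combination r₂
    rw [← hb]; linear_combination (-(X U₂ (u + cornerUnit 2)) ^ 2) * q₂
  have b₁ : X U₁ (u + cornerUnit 1) ^ 2 = (Real.sqrt 2 * X U₁ u + X U₀ u) ^ 2 := by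
    have hb : kcSign U₁ (e 1) * X U₁ (u + cornerUnit 1) = Real.sqrt 2 * X U₁ u + X U₀ u := by
      linear_combination r₁
    rw [← hb]; linear_combination (-(X U₁ (u + cornerUnit 1)) ^ 2) * q₁
  have hs : Real.sqrt 2 ^ 2 = 2 := Real.sq_sqrt zero_le_two
  refine ⟨Real.sqrt 2 * X U₁ u + X U₀ u - X U₂ u, Real.sqrt 2 * X U₃ u - X U₀ u - X U₂ u, ?_⟩
  linear_combination s3u - s3w + s2u - s2w + s1u - s1w - b₀ - b₃ - b₂ - b₁ - (X U₀ u ^ 2 + X U₂ u ^ 2) * hs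

/-- **The site/plaquette Laplacian identity, algebraic core.** For four corner values `a_k` and
signs `σ_k = ±1` with `σ₀σ₁σ₂σ₃ = -1` (the twist of the spinor), the quadratic form
`-2∑ a_k² + 2√2 (σ₀a₀a₃ + σ₁a₁a₀ + σ₂a₂a₁ + σ₃a₃a₂)` is minus a sum of two squares (the signed
4-cycle with an odd number of negative edges has spectrum `±√2`). This is the computation of
Smirnov 2010, Lemma 3.8 / Appendix C in Kadanoff–Ceva variables. [cite: Smirnov2010, Lemma 3.8 and Appendix C] -/
theorem kc_laplacian_core (a₀ a₁ a₂ a₃ σ₀ σ₁ σ₂ σ₃ : ℝ) (h₀ : σ₀ = 1 ∨ σ₀ = -1) (h₁ : σ₁ = 1 ∨ σ₁ = -1)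
    (h₂ : σ₂ = 1 ∨ σ₂ = -1) (h₃ : σ₃ = 1 ∨ σ₃ = -1) (hprod : σ₀ * σ₁ * σ₂ * σ₃ = -1) :
    -2 * (a₀ ^ 2 + a₁ ^ 2 + a₂ ^ 2 + a₃ ^ 2) +
        2 * Real.sqrt 2 * (σ₀ * a₀ * a₃ + σ₁ * a₁ * a₀ + σ₂ * a₂ * a₁ + σ₃ * a₃ * a₂) =
      -((Real.sqrt 2 * σ₁ * a₁ - a₀ - σ₁ * σ₂ * a₂) ^ 2 +
        (Real.sqrt 2 * σ₁ * σ₂ * σ₃ * a₃ + a₀ - σ₁ * σ₂ * a₂) ^ 2) := by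
  have hs : Real.sqrt 2 ^ 2 = 2 := Real.sq_sqrt zero_le_two
  rcases h₀ with rfl | rfl <;> rcases h₁ with rfl | rfl <;> rcases h₂ with rfl | rfl <;>
    rcases h₃ with rfl | rfl <;> norm_num at hprod <;> linear_combination (a₁ ^ 2 + a₃ ^ 2) * hs

/-- `kcSign` is `±1`. [folklore] -/
theorem kcSign_eq_one_or {V : Type*} [DecidableEq V] (T : Finset (Sym2 V)) (e : Sym2 V) :
    kcSign T e = 1 ∨ kcSign T e = -1 := by
  unfold kcSign; split_ifs <;> simp

/-- **The black (plaquette) Laplacian of the Kadanoff–Ceva primitive is a sum of two squares.**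
Let the plaquette `f` and its four side-neighbours `f + e_{j+3}` carry cuts of a cut system, and
let the cut `T_f` contain an odd number of the four sides of `f` — the gauge-invariant way of
saying that `T_f` *ends* at `f` (it holds along any system of dual paths from the source plaquette,
except at the source plaquette itself, where the statement fails: Chelkak–Hongler–Izyurov 2015,
Remark 3.8, "the superharmonicity of `H•` fails at `a + δ`"). Then
`∑_j (Hb(f + e_{j+3}) - Hb(f)) = ∑_j (X(v_j, T_{f+e_{j+3}})² - X(v_j, T_f)²) = P² + Q² ≥ 0`,
`v_j = f + cornerOff j` — the Kadanoff–Ceva form of Smirnov 2010, Lemma 3.8 (black squares,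
`ΔH = +|F(E₀) - F(E₂)|²`) / Chelkak–Hongler–Izyurov 2015, Prop. 3.6 (superharmonicity of `H•`).
Removing a side `s_j ∈ T_f` uses the inverse propagation `X(v_j, T ∖ s_j) = √2 X(v_j,T) + X(v_{j+1},T)`,
which is where the odd parity produces the twist. [cite: Smirnov2010, Lemma 3.8; ChelkakHonglerIzyurovAnnals2015, Prop. 3.6 and Remark 3.8] -/
theorem kc_black_laplacian {Λ : Finset (Site 2)} (η : SpinConfig (Site 2)) (B : Finset (Site 2))
    {cut : Site 2 → Finset (Sym2 (Site 2))} {P : Set (Site 2)} (h : IsKCCuts G₂ Λ cut P)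
    {f : Site 2} (hf : f ∈ P) (hP : ∀ j : Fin 4, f + cornerUnit (j + 3) ∈ P)
    (hsides : ∀ j : Fin 4, s(f + cornerOff j, f + cornerOff j + cornerUnit j) ∈ edgesTouching G₂ Λ)
    (hodd : Odd #(Finset.univ.filter fun j : Fin 4 =>
      s(f + cornerOff j, f + cornerOff j + cornerUnit j) ∈ cut f)) :
    ∃ P₁ Q₁ : ℝ, ∑ j : Fin 4, (kcFlux G₂ Λ criticalBetaTwo (.fixed η) B cut (f + cornerOff j, j + 3) -
        kcFlux G₂ Λ criticalBetaTwo (.fixed η) B cut (f + cornerOff j, j)) = P₁ ^ 2 + Q₁ ^ 2 := by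
  set X : Finset (Sym2 (Site 2)) → Site 2 → ℝ := fun T v => kcCorner G₂ Λ criticalBetaTwo (.fixed η) B T v
    with hX
  set T := cut f with hT
  set v : Fin 4 → Site 2 := fun j => f + cornerOff j with hv
  set sd : Fin 4 → Sym2 (Site 2) := fun j => s(v j, v j + cornerUnit j) with hsd
  have hTsub : T ⊆ edgesTouching G₂ Λ := h.subset _ hf
  -- the steps of the cut system across the four sides
  have hstep : ∀ j : Fin 4, sd j ∈ edgesTouching G₂ Λ ∧
      KCGaugeEquiv G₂ Λ (symmDiff T {sd j}) (cut (f + cornerUnit (j + 3))) := by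
    intro j
    have h1 : faceAt (v j) j = f := faceAt_add_cornerOff f j
    have h2 : faceAt (v j) (j + 3) = f + cornerUnit (j + 3) := faceAt_face_corner_add_three f j
    rcases h.step (v j) j (h1 ▸ hf) (h2 ▸ hP j) with ⟨hek, S, hS, hcut⟩ | ⟨hu, hu'⟩
    · rw [h1, h2] at hcut
      exact ⟨hek, S, hS, hcut⟩
    · exfalso
      have hsj := hsides j
      rw [mem_edgesTouching_iff] at hsj
      obtain ⟨-, x, hx, hxe⟩ := hsj
      rcases Sym2.mem_iff.1 hxe with rfl | rfl
      · exact hu hx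
      · exact hu' hx
  -- fluxes
  have flux_in : ∀ j : Fin 4, kcFlux G₂ Λ criticalBetaTwo (.fixed η) B cut (f + cornerOff j, j) = X T (v j) ^ 2 := by
    intro j
    simp only [kcFlux, cFace, hX, hT, hv, faceAt_add_cornerOff]
  have flux_out : ∀ j : Fin 4, kcFlux G₂ Λ criticalBetaTwo (.fixed η) B cut (f + cornerOff j, j + 3) =
      X (symmDiff T {sd j}) (v j) ^ 2 := by
    intro j
    have hsub := symmDiff_singleton_subset_edgesTouching G₂ hTsub (hstep j).1
    simp only [kcFlux, cFace, faceAt_face_corner_add_three]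
    exact (hstep j).2.kcCorner_sq G₂ hsub _ η B (v j)
  -- propagation across each side: `X(v_j, T ∆ s_j) = √2 α_j - ε_j α_{j+1}`
  have hvs : ∀ j : Fin 4, v j + cornerUnit j = v (j + 1) := fun j => (add_cornerOff_succ f j).symm
  have rel : ∀ j : Fin 4, X (symmDiff T {sd j}) (v j) =
      Real.sqrt 2 * X T (v j) - kcSign T (sd j) * X T (v (j + 1)) := by
    intro j
    rw [← hvs j]
    exact kcCorner_symmDiff_singleton_critical G₂ Λ _ B T (v j) (v j + cornerUnit j)
  -- the product of the four signs is `-1`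
  have hprod : kcSign T (sd 0) * kcSign T (sd 1) * kcSign T (sd 2) * kcSign T (sd 3) = -1 := by
    have hp : ∏ j : Fin 4, kcSign T (sd j) = (-1) ^ #(Finset.univ.filter fun j : Fin 4 => sd j ∈ T) := by
      simp only [kcSign]
      rw [prod_ite, prod_const, prod_const_one, mul_one]
    rw [Fin.prod_univ_four] at hp
    rw [hp]
    exact Odd.neg_one_pow hodd
  rw [Fin.sum_univ_four]
  simp only [flux_in, flux_out, rel]
  have e3 : (3 : Fin 4) + 1 = 0 := rfl
  simp only [show (0 : Fin 4) + 1 = 1 from rfl, show (1 : Fin 4) + 1 = 2 from rfl,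
    show (2 : Fin 4) + 1 = 3 from rfl, e3]
  have core := kc_laplacian_core (X T (v 0)) (X T (v 3)) (X T (v 2)) (X T (v 1))
    (kcSign T (sd 0)) (kcSign T (sd 3)) (kcSign T (sd 2)) (kcSign T (sd 1))
    (kcSign_eq_one_or T _) (kcSign_eq_one_or T _) (kcSign_eq_one_or T _) (kcSign_eq_one_or T _)
    (by linear_combination hprod)
  have q₀ := kcSign_mul_self T (sd 0)
  have q₁ := kcSign_mul_self T (sd 1)
  have q₂ := kcSign_mul_self T (sd 2)
  have q₃ := kcSign_mul_self T (sd 3)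
  have hs : Real.sqrt 2 ^ 2 = 2 := Real.sq_sqrt zero_le_two
  refine ⟨Real.sqrt 2 * kcSign T (sd 3) * X T (v 3) - X T (v 0) - kcSign T (sd 3) * kcSign T (sd 2) * X T (v 2),
    Real.sqrt 2 * kcSign T (sd 3) * kcSign T (sd 2) * kcSign T (sd 1) * X T (v 1) + X T (v 0) -
      kcSign T (sd 3) * kcSign T (sd 2) * X T (v 2), ?_⟩
  linear_combination -core + (X T (v 1) ^ 2) * q₀ + (X T (v 2) ^ 2) * q₁ + (X T (v 3) ^ 2) * q₂ +
    (X T (v 0) ^ 2) * q₃ + (X T (v 0) ^ 2 + X T (v 1) ^ 2 + X T (v 2) ^ 2 + X T (v 3) ^ 2) * hs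

/-! ### Primitives of the flux form and their Laplacians -/

/-- **A discrete primitive of the Kadanoff–Ceva flux form** on the set `P` of plaquettes (the pair
`(Hw, Hb)` of Chelkak–Hongler–Izyurov 2015, Prop. 3.6: `H°` on faces = sites, `H•` on vertices =
plaquettes, `H• (p) - H° (v) = |F(corner)|²` in the tree's orientation). [cite: ChelkakHonglerIzyurovAnnals2015, Prop. 3.6] -/
def IsKCPrimitive (Λ : Finset (Site 2)) (β : ℝ) (bc : BoundaryCondition (Site 2)) (B : Finset (Site 2))
    (cut : Site 2 → Finset (Sym2 (Site 2))) (Hw Hb : Site 2 → ℝ) (P : Set (Site 2)) : Prop :=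
  ∀ q ∈ faceSetCorners P, Hb (cFace q) - Hw q.1 = kcFlux G₂ Λ β bc B cut q

namespace IsKCPrimitive

variable {G₂}
variable {Λ : Finset (Site 2)} {β : ℝ} {bc : BoundaryCondition (Site 2)} {B : Finset (Site 2)}
  {cut : Site 2 → Finset (Sym2 (Site 2))} {Hw Hb : Site 2 → ℝ} {P : Set (Site 2)}

/-- **White increments**: `Hw(u + e_k) - Hw(u) = X(u, T_p)² - X(u + e_k, T_p)²`, `p = faceAt u k ∈ P`
(Chelkak–Hongler–Izyurov 2015, Prop. 3.6, eq. (3.4) applied at the two corners of `p` on `e_k`).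
[cite: ChelkakHonglerIzyurovAnnals2015, Prop. 3.6] -/
theorem white_increment (h : IsKCPrimitive G₂ Λ β bc B cut Hw Hb P) (u : Site 2) (k : Fin 4)
    (hk : faceAt u k ∈ P) :
    Hw (u + cornerUnit k) - Hw u =
      kcFlux G₂ Λ β bc B cut (u, k) - kcFlux G₂ Λ β bc B cut (u + cornerUnit k, k + 1) := by
  have e₁ := h (u, k) (by simpa [faceSetCorners, cFace] using hk)
  have e₂ := h (u + cornerUnit k, k + 1) (by simpa [faceSetCorners, cFace, faceAt_add_unit_succ] using hk)
  simp only [cFace] at e₁ e₂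
  rw [faceAt_add_unit_succ] at e₂
  linarith

/-- **Black increments**: across the `j`-th side of the plaquette `f ∈ P` towards `f + e_{j+3} ∈ P`,
`Hb(f + e_{j+3}) - Hb(f) = X(v_j, T_{f+e_{j+3}})² - X(v_j, T_f)²`, `v_j = f + cornerOff j`.
[cite: ChelkakHonglerIzyurovAnnals2015, Prop. 3.6] -/
theorem black_increment (h : IsKCPrimitive G₂ Λ β bc B cut Hw Hb P) (f : Site 2) (j : Fin 4)
    (hf : f ∈ P) (hf' : f + cornerUnit (j + 3) ∈ P) :
    Hb (f + cornerUnit (j + 3)) - Hb f =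
      kcFlux G₂ Λ β bc B cut (f + cornerOff j, j + 3) - kcFlux G₂ Λ β bc B cut (f + cornerOff j, j) := by
  have e₁ := h (f + cornerOff j, j) (by simp [faceSetCorners, cFace, faceAt_add_cornerOff, hf])
  have e₂ := h (f + cornerOff j, j + 3) (by simp [faceSetCorners, cFace, faceAt_face_corner_add_three, hf'])
  simp only [cFace, faceAt_add_cornerOff] at e₁
  simp only [cFace, faceAt_face_corner_add_three] at e₂
  linarith

/-- **`Hw` is superharmonic at the free sites off the background spins** (critical `β`, fixed
boundary condition; Chelkak–Hongler–Izyurov 2015, Prop. 3.6: "`H°` is `Δ°`-subharmonic on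
`𝒱° ∖ {a, a₁, …, a_k}`", in their sign convention): `Δ Hw (u) = -(P² + Q²) ≤ 0`.
[cite: ChelkakHonglerIzyurovAnnals2015, Prop. 3.6; Smirnov2010, Lemma 3.8] -/
theorem latticeLaplacian_white {η : SpinConfig (Site 2)}
    (h : IsKCPrimitive G₂ Λ criticalBetaTwo (.fixed η) B cut Hw Hb P) (hc : IsKCCuts G₂ Λ cut P)
    {u : Site 2} (hu : u ∈ Λ) (huB : u ∉ B) (hP : ∀ k : Fin 4, faceAt u k ∈ P)
    (hbd : edgeBoundary G₂ {u} = Finset.univ.image fun k : Fin 4 => cSrc (u, k)) :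
    ∃ P₁ Q₁ : ℝ, latticeLaplacian Hw u = -(P₁ ^ 2 + Q₁ ^ 2) := by
  obtain ⟨P₁, Q₁, hPQ⟩ := kc_white_laplacian G₂ η hc hu huB hP hbd
  refine ⟨P₁, Q₁, ?_⟩
  rw [latticeLaplacian, ← hPQ]
  exact Finset.sum_congr rfl fun k _ => h.white_increment u k (hP k)

/-- `Δ Hw ≤ 0` at such sites. [cite: ChelkakHonglerIzyurovAnnals2015, Prop. 3.6] -/
theorem latticeLaplacian_white_nonpos {η : SpinConfig (Site 2)}
    (h : IsKCPrimitive G₂ Λ criticalBetaTwo (.fixed η) B cut Hw Hb P) (hc : IsKCCuts G₂ Λ cut P)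
    {u : Site 2} (hu : u ∈ Λ) (huB : u ∉ B) (hP : ∀ k : Fin 4, faceAt u k ∈ P)
    (hbd : edgeBoundary G₂ {u} = Finset.univ.image fun k : Fin 4 => cSrc (u, k)) :
    latticeLaplacian Hw u ≤ 0 := by
  obtain ⟨P₁, Q₁, hPQ⟩ := h.latticeLaplacian_white hc hu huB hP hbd
  rw [hPQ]
  nlinarith [sq_nonneg P₁, sq_nonneg Q₁]

/-- **`Hb` is subharmonic at the plaquettes where the cut ends** (critical `β`, fixed boundary
condition; all four sides touching `Λ`, all four neighbours in `P`, odd number of sides in the cut;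
Chelkak–Hongler–Izyurov 2015, Prop. 3.6: "`H•` is `Δ•`-superharmonic on `𝒱• ∖ {a + δ}`", in their
sign convention): `Δ Hb (f) = P² + Q² ≥ 0`. [cite: ChelkakHonglerIzyurovAnnals2015, Prop. 3.6; Smirnov2010, Lemma 3.8] -/
theorem latticeLaplacian_black {η : SpinConfig (Site 2)}
    (h : IsKCPrimitive G₂ Λ criticalBetaTwo (.fixed η) B cut Hw Hb P) (hc : IsKCCuts G₂ Λ cut P)
    {f : Site 2} (hf : f ∈ P) (hP : ∀ j : Fin 4, f + cornerUnit (j + 3) ∈ P)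
    (hsides : ∀ j : Fin 4, s(f + cornerOff j, f + cornerOff j + cornerUnit j) ∈ edgesTouching G₂ Λ)
    (hodd : Odd #(Finset.univ.filter fun j : Fin 4 =>
      s(f + cornerOff j, f + cornerOff j + cornerUnit j) ∈ cut f)) :
    ∃ P₁ Q₁ : ℝ, latticeLaplacian Hb f = P₁ ^ 2 + Q₁ ^ 2 := by
  obtain ⟨P₁, Q₁, hPQ⟩ := kc_black_laplacian G₂ η B hc hf hP hsides hodd
  refine ⟨P₁, Q₁, ?_⟩
  rw [latticeLaplacian, ← hPQ]
  symm
  exact Fintype.sum_equiv (Equiv.addRight (3 : Fin 4)) _ _ fun j => (h.black_increment f j hf (hP j)).symm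

/-- `Δ Hb ≥ 0` at such plaquettes. [cite: ChelkakHonglerIzyurovAnnals2015, Prop. 3.6] -/
theorem latticeLaplacian_black_nonneg {η : SpinConfig (Site 2)}
    (h : IsKCPrimitive G₂ Λ criticalBetaTwo (.fixed η) B cut Hw Hb P) (hc : IsKCCuts G₂ Λ cut P)
    {f : Site 2} (hf : f ∈ P) (hP : ∀ j : Fin 4, f + cornerUnit (j + 3) ∈ P)
    (hsides : ∀ j : Fin 4, s(f + cornerOff j, f + cornerOff j + cornerUnit j) ∈ edgesTouching G₂ Λ)
    (hodd : Odd #(Finset.univ.filter fun j : Fin 4 =>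
      s(f + cornerOff j, f + cornerOff j + cornerUnit j) ∈ cut f)) :
    0 ≤ latticeLaplacian Hb f := by
  obtain ⟨P₁, Q₁, hPQ⟩ := h.latticeLaplacian_black hc hf hP hsides hodd
  rw [hPQ]
  positivity

/-- **`Hw` is constant along the frozen boundary**: if the bond `{v, v + e_k}` has both endpoints
frozen and borders a plaquette `faceAt v k ∈ P`, then `Hw (v + e_k) = Hw v` (both corner values at
frozen sites are `±⟨μ_T σ_B⟩`; Chelkak–Hongler–Izyurov 2015, Prop. 3.6: "`H°` satisfies Dirichlet
boundary conditions", the lattice reason being the boundary condition (2.4) of Prop. 2.4).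
[cite: ChelkakHonglerIzyurovAnnals2015, Prop. 3.6 and Prop. 2.4] -/
theorem hw_eq_of_frozen {η : SpinConfig (Site 2)} (h : IsKCPrimitive G₂ Λ β (.fixed η) B cut Hw Hb P)
    {v : Site 2} {k : Fin 4} (hk : faceAt v k ∈ P) (hv : v ∉ Λ) (hv' : v + cornerUnit k ∉ Λ) :
    Hw (v + cornerUnit k) = Hw v := by
  have h1 := h.white_increment v k hk
  simp only [kcFlux, cFace, faceAt_add_unit_succ] at h1
  rw [kcCorner_of_notMem G₂ Λ β η B _ hv, kcCorner_of_notMem G₂ Λ β η B _ hv', mul_pow, mul_pow,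
    spinAt_sq, spinAt_sq] at h1
  linarith

/-- **The jump of `H` from a frozen site into its plaquette is the squared disorder correlation**:
`Hb (faceAt v k) - Hw v = ⟨μ_{T} σ_B⟩²` for `v ∉ Λ`, `T` the cut of that plaquette.
[cite: ChelkakHonglerIzyurovAnnals2015, Prop. 3.6 and Prop. 2.4] -/
theorem hb_sub_hw_of_frozen {η : SpinConfig (Site 2)} (h : IsKCPrimitive G₂ Λ β (.fixed η) B cut Hw Hb P)
    {v : Site 2} {k : Fin 4} (hk : faceAt v k ∈ P) (hv : v ∉ Λ) :
    Hb (faceAt v k) - Hw v =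
      isingExpect G₂ Λ β 0 (.fixed η) (fun σ => disorderWeight β (cut (faceAt v k)) σ * spinProduct B σ) ^ 2 := by
  have e₁ := h (v, k) (by simpa [faceSetCorners, cFace] using hk)
  simp only [cFace, kcFlux] at e₁
  rw [kcCorner_of_notMem G₂ Λ β η B _ hv, mul_pow, spinAt_sq, one_mul] at e₁
  exact e₁

end IsKCPrimitive

/-- **Existence of a primitive** for an admissible system of cuts on a hole-free finite set of
plaquettes, in the `IsKCPrimitive` packaging. [cite: ChelkakHonglerIzyurovAnnals2015, Prop. 3.6] -/
theorem IsKCCuts.exists_isKCPrimitive {Λ : Finset (Site 2)} (β : ℝ) (η : SpinConfig (Site 2))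
    (B : Finset (Site 2)) {cut : Site 2 → Finset (Sym2 (Site 2))} {P : Finset (Site 2)}
    (hP : HoleFree (↑P : Set (Site 2))) (h : IsKCCuts G₂ Λ cut ↑P) :
    ∃ Hw Hb : Site 2 → ℝ, IsKCPrimitive G₂ Λ β (.fixed η) B cut Hw Hb ↑P :=
  h.exists_primitive G₂ β η B hP

end Laplacian




/-! ## Existence of admissible systems of cuts -/

section CutExistence

open SimpleGraph

variable (G₂ : SimpleGraph (Site 2)) [G₂.LocallyFinite]

/-- A lattice bond with an endpoint in `Λ` is an interacting bond of the domain graph, provided the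
domain graph joins every site of `Λ` to its four lattice neighbours (as `discreteDomainGraph` does
for the free sites `meshInteriorFinset`). [folklore] -/
theorem mem_edgesTouching_of_usable {Λ : Finset (Site 2)} (hG : ∀ v ∈ Λ, ∀ k : Fin 4, G₂.Adj v (v + cornerUnit k))
    {b : Sym2 (Site 2)} (hb : b ∈ (zdGraph 2).edgeSet) (hx : ∃ x ∈ Λ, x ∈ b) : b ∈ edgesTouching G₂ Λ := by
  obtain ⟨x, hxΛ, hxb⟩ := hx
  induction b using Sym2.ind with
  | _ a c =>
    rw [SimpleGraph.mem_edgeSet] at hb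
    have key : ∀ {a c : Site 2}, (zdGraph 2).Adj a c → a ∈ Λ → s(a, c) ∈ edgesTouching G₂ Λ := by
      intro a c hac ha
      obtain ⟨k, rfl⟩ := exists_eq_add_cornerUnit hac
      exact mem_edgesTouching_iff.2 ⟨(SimpleGraph.mem_edgeSet G₂).2 (hG a ha k), a, ha, Sym2.mem_mk_left _ _⟩
    rcases Sym2.mem_iff.1 hxb with rfl | rfl
    · exact key hb hxΛ
    · rw [Sym2.eq_swap]; exact key hb.symm hxΛ

/-- For `S ⊆ Λ` the edge boundary in the domain graph is the edge boundary in `ℤ²` (all bonds at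
free sites are interacting, and the domain graph is a subgraph of the lattice). [folklore] -/
theorem edgeBoundary_eq_of_subset {Λ : Finset (Site 2)} (hG : ∀ v ∈ Λ, ∀ k : Fin 4, G₂.Adj v (v + cornerUnit k))
    (hle : G₂ ≤ zdGraph 2) {S : Finset (Site 2)} (hS : S ⊆ Λ) :
    edgeBoundary G₂ S = edgeBoundary (zdGraph 2) S := by
  ext b
  induction b using Sym2.ind with
  | _ a c =>
    rw [mk_mem_edgeBoundary_iff, mk_mem_edgeBoundary_iff]
    constructor
    · rintro ⟨h, h'⟩; exact ⟨hle h, h'⟩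
    · rintro ⟨h, h'⟩
      refine ⟨?_, h'⟩
      by_cases ha : a ∈ S
      · obtain ⟨k, rfl⟩ := exists_eq_add_cornerUnit h
        exact hG a (hS ha) k
      · have hc : c ∈ S := by by_contra hc; exact ha (h'.2 hc)
        obtain ⟨k, rfl⟩ := exists_eq_add_cornerUnit h.symm
        exact (hG c (hS hc) k).symm

/-- A step of a dual walk is **usable** for branch cuts if the bond it crosses touches `Λ`. [cite: ChelkakHonglerIzyurov2021, §2.2] -/
def UsableWalk (Λ : Finset (Site 2)) {p q : Site 2} (W : (zdGraph 2).Walk p q) : Prop :=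
  ∀ d ∈ W.darts, ∃ x ∈ Λ, x ∈ plaqBond d.fst d.snd

/-- Usability of concatenations. [folklore] -/
theorem UsableWalk.append {Λ : Finset (Site 2)} {p q r : Site 2} {W : (zdGraph 2).Walk p q} {W' : (zdGraph 2).Walk q r}
    (h : UsableWalk Λ W) (h' : UsableWalk Λ W') : UsableWalk Λ (W.append W') := by
  intro d hd
  rw [Walk.darts_append, List.mem_append] at hd
  rcases hd with hd | hd
  · exact h d hd
  · exact h' d hd

/-- Usability of reversals. [folklore] -/
theorem UsableWalk.reverse {Λ : Finset (Site 2)} {p q : Site 2} {W : (zdGraph 2).Walk p q} (h : UsableWalk Λ W) :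
    UsableWalk Λ W.reverse := by
  intro d hd
  rw [Walk.darts_reverse, List.mem_reverse, List.mem_map] at hd
  obtain ⟨d', hd', rfl⟩ := hd
  obtain ⟨x, hx, hxb⟩ := h d' hd'
  refine ⟨x, hx, ?_⟩
  simp only [Dart.symm_toProd, Prod.fst_swap, Prod.snd_swap]
  rwa [plaqBond_comm_of_adj d'.adj]

/-- Usability of a single step across a bond touching `Λ`. [folklore] -/
theorem usableWalk_cons_nil {Λ : Finset (Site 2)} {p q : Site 2} (h : (zdGraph 2).Adj p q)
    (hx : ∃ x ∈ Λ, x ∈ plaqBond p q) : UsableWalk Λ (Walk.cons h Walk.nil) := by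
  intro d hd
  simp only [Walk.darts_cons, Walk.darts_nil, List.mem_singleton] at hd
  subst hd
  exact hx

/-- The empty walk is usable. [folklore] -/
theorem usableWalk_nil (Λ : Finset (Site 2)) (p : Site 2) : UsableWalk Λ (Walk.nil : (zdGraph 2).Walk p p) :=
  fun d hd => by simp at hd

/-- The cut of a usable walk consists of interacting bonds. [folklore] -/
theorem crossSet_subset_edgesTouching {Λ : Finset (Site 2)} (hG : ∀ v ∈ Λ, ∀ k : Fin 4, G₂.Adj v (v + cornerUnit k))
    {p q : Site 2} {W : (zdGraph 2).Walk p q} (h : UsableWalk Λ W) : crossSet W ⊆ edgesTouching G₂ Λ := by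
  intro b hb
  obtain ⟨d, hd, rfl⟩ := exists_dart_of_mem_crossSet W hb
  exact mem_edgesTouching_of_usable G₂ hG (plaqBond_mem_edgeSet d.adj) (h d hd)

/-- **Existence of admissible systems of branch cuts** (the construction behind "a branch cut `γ`
for the double cover", Chelkak–Hongler–Izyurov 2021, §2.2, on a general discrete domain). Let the
domain graph join every free site to its four neighbours and be a subgraph of `ℤ²`, let the set
`Λ` of free sites be hole-free as a set of cells, and let every plaquette of `P` be reachable from
the source plaquette `p₀ ∈ P` by a dual walk crossing only bonds touching `Λ`. Then the cuts
"bonds crossed an odd number of times by such a walk" form an admissible system (`IsKCCuts`):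
across a bond touching `Λ` the two cuts differ by that bond and by `∂S`, `S` the set of sites of
odd winding of the closed dual walk so formed — free sites by hole-freeness (`oddFinset_subset`,
`edgeBoundary_oddFinset`) —; moreover the cut of the source is empty and every other cut contains
an odd number of sides of its plaquette (`odd_card_plaqSide_mem_crossSet`).
[cite: ChelkakHonglerIzyurov2021, §2.2 and Lemma 2.4] -/
theorem exists_isKCCuts {Λ : Finset (Site 2)} (hG : ∀ v ∈ Λ, ∀ k : Fin 4, G₂.Adj v (v + cornerUnit k))
    (hle : G₂ ≤ zdGraph 2) (hΛ : HoleFree (↑Λ : Set (Site 2))) {P : Set (Site 2)} {p₀ : Site 2}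
    (hconn : ∀ p ∈ P, ∃ W : (zdGraph 2).Walk p₀ p, UsableWalk Λ W) :
    ∃ cut : Site 2 → Finset (Sym2 (Site 2)), IsKCCuts G₂ Λ cut P ∧ cut p₀ = ∅ ∧
      (∀ p ∈ P, p ≠ p₀ → Odd #(Finset.univ.filter fun j : Fin 4 => plaqSide p j ∈ cut p)) ∧
      ∀ p, cut p ⊆ edgesTouching G₂ Λ := by
  classical
  -- the chosen walks (empty at the source) and their cuts
  let walk : ∀ p : Site 2, p ∈ P → (zdGraph 2).Walk p₀ p := fun p hp =>
    if h : p = p₀ then h ▸ Walk.nil else (hconn p hp).choose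
  have walk_usable : ∀ (p : Site 2) (hp : p ∈ P), UsableWalk Λ (walk p hp) := by
    intro p hp
    by_cases h : p = p₀
    · subst h; simp only [walk, dif_pos rfl]; exact usableWalk_nil Λ _
    · simp only [walk, dif_neg h]; exact (hconn p hp).choose_spec
  let cut : Site 2 → Finset (Sym2 (Site 2)) := fun p => if hp : p ∈ P then crossSet (walk p hp) else ∅
  have cut_eq : ∀ (p : Site 2) (hp : p ∈ P), cut p = crossSet (walk p hp) := fun p hp => by
    simp only [cut, dif_pos hp]
  have cut_sub : ∀ p, cut p ⊆ edgesTouching G₂ Λ := by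
    intro p
    by_cases hp : p ∈ P
    · rw [cut_eq p hp]
      exact crossSet_subset_edgesTouching G₂ hG (walk_usable p hp)
    · simp only [cut, dif_neg hp]; exact Finset.empty_subset _
  refine ⟨cut, ⟨fun p _ => cut_sub p, ?_⟩, ?_, ?_, cut_sub⟩
  · -- the step across an interior bond
    intro u k hk hk3
    by_cases hus : ∃ x ∈ Λ, x ∈ cSrc (u, k)
    · refine Or.inl ⟨?_, ?_⟩
      · exact mem_edgesTouching_of_usable G₂ hG (cSrc_mem_edgeSet (u, k)) hus
      · -- the closed walk `p₀ → p_L → p_R → p₀`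
        set WL := walk (faceAt u k) hk with hWL
        set WR := walk (faceAt u (k + 3)) hk3 with hWR
        have hadj := zdGraph_adj_faceAt_faceAt_add_three u k
        have hbond : plaqBond (faceAt u k) (faceAt u (k + 3)) = cSrc (u, k) := plaqBond_faceAt u k
        let C : (zdGraph 2).Walk p₀ p₀ := (WL.append (Walk.cons hadj Walk.nil)).append WR.reverse
        have hC : UsableWalk Λ C :=
          ((walk_usable _ hk).append (usableWalk_cons_nil hadj (hbond ▸ hus))).append (walk_usable _ hk3).reverse
        have hcross : crossSet C = symmDiff (symmDiff (crossSet WL) {cSrc (u, k)}) (crossSet WR) := by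
          simp only [C, crossSet_append, crossSet_cons_nil, crossSet_reverse, hbond]
        refine ⟨oddFinset C, oddFinset_subset C hΛ hC, ?_⟩
        rw [cut_eq _ hk3, cut_eq _ hk, edgeBoundary_eq_of_subset G₂ hG hle (oddFinset_subset C hΛ hC),
          edgeBoundary_oddFinset C, hcross, ← hWL, ← hWR]
        rw [symmDiff_symmDiff_cancel_left]
    · refine Or.inr ⟨fun hu => hus ⟨u, hu, Sym2.mem_mk_left _ _⟩, fun hu => hus ⟨_, hu, Sym2.mem_mk_right _ _⟩⟩
  · -- the source
    by_cases hp₀ : p₀ ∈ P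
    · rw [cut_eq p₀ hp₀]; simp only [walk, dif_pos rfl]; rfl
    · simp only [cut, dif_neg hp₀]
  · -- parity
    intro p hp hne
    rw [cut_eq p hp]
    simp only [walk, dif_neg hne]
    exact odd_card_plaqSide_mem_crossSet _ (Ne.symm hne)


/-! ### The boundary modification: subharmonicity of `Hb` up to the frozen boundary -/

section BoundaryMod

variable (G₂ : SimpleGraph (Site 2)) [G₂.LocallyFinite]

/-- **The boundary-modified plaquette Laplacian** of Chelkak–Hongler–Izyurov 2015, §3.3.1 /
Chelkak–Smirnov 2012, §3.6 ("boundary modification trick"), in the tree's orientation: across a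
side of `f` touching `Λ` the usual difference `Hb(f') - Hb(f)` to the plaquette `f'` beyond it;
across a side with both endpoints frozen the difference to the Dirichlet value `Hw` of the frozen
boundary, weighted by the conductance `2(√2 - 1)` (CHI15: "`c(w,z) = 2(√2 - 1)` for the boundary
edges"). [cite: ChelkakHonglerIzyurovAnnals2015, §3.3.1 (definition of Δ•_δ); ChelkakSmirnov2012Ising, Lemma 3.14] -/
def kcModLaplacian (Λ : Finset (Site 2)) (Hw Hb : Site 2 → ℝ) (f : Site 2) : ℝ :=
  ∑ j : Fin 4, if f + cornerOff j ∈ Λ ∨ f + cornerOff j + cornerUnit j ∈ Λ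
    then Hb (f + cornerUnit (j + 3)) - Hb f
    else 2 * (Real.sqrt 2 - 1) * (Hw (f + cornerOff j) - Hb f)

/-- **Subharmonicity of `Hb` for the boundary-modified Laplacian** (Chelkak–Hongler–Izyurov 2015,
Prop. 3.6 (iv) with the modified `Δ•`: "`H•` is `Δ•`-superharmonic on `𝒱• ∖ {a + δ}`", in their sign
convention; Chelkak–Smirnov 2012, Lemma 3.14). At a plaquette `f` of an admissible cut system
whose cut contains an odd number of its sides, for a CONSTANT fixed boundary condition (e.g. `+`),
`kcModLaplacian Λ Hw Hb f = P² + Q² ≥ 0`, provided the plaquettes beyond the sides touching `Λ` belong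
to the system. Mechanism: across a frozen side `{v_j, v_{j+1}}` the corner values are equal
(`X(v_j,T) = X(v_{j+1},T)`, constant boundary spins), so the weighted Dirichlet term
`-2(√2-1) X(v_j,T)²` coincides with the term `(√2 X(v_j,T) - X(v_{j+1},T))² - X(v_j,T)²` that a genuine
neighbour with the toggled cut would contribute — the computation of Chelkak–Smirnov's Lemma 3.14 —
and the black identity `kc_laplacian_core` applies verbatim.
[cite: ChelkakHonglerIzyurovAnnals2015, Prop. 3.6; ChelkakSmirnov2012Ising, Lemma 3.14] -/
theorem IsKCPrimitive.kcModLaplacian_eq {Λ : Finset (Site 2)} {η : SpinConfig (Site 2)}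
    (hη : ∀ v w : Site 2, spinAt v η = spinAt w η) {B : Finset (Site 2)}
    {cut : Site 2 → Finset (Sym2 (Site 2))} {Hw Hb : Site 2 → ℝ} {P : Set (Site 2)}
    (h : IsKCPrimitive G₂ Λ criticalBetaTwo (.fixed η) B cut Hw Hb P) (hc : IsKCCuts G₂ Λ cut P)
    {f : Site 2} (hf : f ∈ P)
    (hP : ∀ j : Fin 4, (f + cornerOff j ∈ Λ ∨ f + cornerOff j + cornerUnit j ∈ Λ) → f + cornerUnit (j + 3) ∈ P)
    (hodd : Odd #(Finset.univ.filter fun j : Fin 4 =>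
      s(f + cornerOff j, f + cornerOff j + cornerUnit j) ∈ cut f)) :
    ∃ P₁ Q₁ : ℝ, kcModLaplacian Λ Hw Hb f = P₁ ^ 2 + Q₁ ^ 2 := by
  set X : Finset (Sym2 (Site 2)) → Site 2 → ℝ := fun T v => kcCorner G₂ Λ criticalBetaTwo (.fixed η) B T v
    with hX
  set T := cut f with hT
  set v : Fin 4 → Site 2 := fun j => f + cornerOff j with hv
  set sd : Fin 4 → Sym2 (Site 2) := fun j => s(v j, v j + cornerUnit j) with hsd
  have hTsub : T ⊆ edgesTouching G₂ Λ := hc.subset _ hf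
  have hvs : ∀ j : Fin 4, v j + cornerUnit j = v (j + 1) := fun j => (add_cornerOff_succ f j).symm
  -- each side contributes `(√2 α_j - ε_j α_{j+1})² - α_j²`
  have hside : ∀ j : Fin 4,
      (if f + cornerOff j ∈ Λ ∨ f + cornerOff j + cornerUnit j ∈ Λ
        then Hb (f + cornerUnit (j + 3)) - Hb f
        else 2 * (Real.sqrt 2 - 1) * (Hw (f + cornerOff j) - Hb f)) =
      (Real.sqrt 2 * X T (v j) - kcSign T (sd j) * X T (v (j + 1))) ^ 2 - X T (v j) ^ 2 := by
    intro j
    have h1 : faceAt (v j) j = f := faceAt_add_cornerOff f j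
    have h2 : faceAt (v j) (j + 3) = f + cornerUnit (j + 3) := faceAt_face_corner_add_three f j
    -- the inner flux at the corner `(v j, j)`
    have e_in : Hb f - Hw (v j) = X T (v j) ^ 2 := by
      have := h (v j, j) (by simp [faceSetCorners, cFace, h1, hf])
      simpa [cFace, h1, kcFlux, hX, hT] using this
    split_ifs with hus
    · -- a side touching `Λ`: a genuine neighbour with a gauge-equivalent toggled cut
      have hf' := hP j hus
      have e_out : Hb (f + cornerUnit (j + 3)) - Hw (v j) = X (symmDiff T {sd j}) (v j) ^ 2 := by
        have e2 := h (v j, j + 3) (by simp [faceSetCorners, cFace, h2, hf'])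
        simp only [cFace, h2, kcFlux] at e2
        rcases hc.step (v j) j (h1 ▸ hf) (h2 ▸ hf') with ⟨hek, S, hS, hcut⟩ | ⟨hu, hu'⟩
        · rw [h1, h2] at hcut
          have hsub := symmDiff_singleton_subset_edgesTouching G₂ hTsub hek
          rw [e2, hcut]
          exact (KCGaugeEquiv.kcCorner_sq G₂ ⟨S, hS, rfl⟩ hsub _ η B (v j))
        · exfalso; rcases hus with hx | hx
          · exact hu hx
          · exact hu' hx
      have rel : X (symmDiff T {sd j}) (v j) = Real.sqrt 2 * X T (v j) - kcSign T (sd j) * X T (v (j + 1)) := by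
        rw [← hvs j]; exact kcCorner_symmDiff_singleton_critical G₂ Λ _ B T (v j) (v j + cornerUnit j)
      rw [← rel]; linarith
    · -- a frozen side: the boundary modification trick
      rw [not_or] at hus
      obtain ⟨hvj, hvj'⟩ := hus
      have hnotT : sd j ∉ T := by
        intro hmem
        have := mem_edgesTouching_iff.1 (hTsub hmem)
        obtain ⟨-, x, hx, hxe⟩ := this
        rcases Sym2.mem_iff.1 hxe with rfl | rfl
        · exact hvj hx
        · exact hvj' hx
      have hsign : kcSign T (sd j) = 1 := by simp [kcSign, hnotT]
      -- equal corner values at the two frozen endpoints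
      have hval : X T (v (j + 1)) = X T (v j) := by
        rw [← hvs j]
        simp only [hX]
        rw [kcCorner_of_notMem G₂ Λ _ η B _ hvj, kcCorner_of_notMem G₂ Λ _ η B _ hvj', hη (v j + cornerUnit j) (v j)]
      rw [hsign, hval, one_mul, show Hw (f + cornerOff j) - Hb f = -(X T (v j) ^ 2) by rw [← e_in]; ring]
      have hs : Real.sqrt 2 ^ 2 = 2 := Real.sq_sqrt zero_le_two
      linear_combination (-(X T (v j) ^ 2)) * hs
  -- the product of the four signs is `-1`
  have hprod : kcSign T (sd 0) * kcSign T (sd 1) * kcSign T (sd 2) * kcSign T (sd 3) = -1 := by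
    have hp : ∏ j : Fin 4, kcSign T (sd j) = (-1) ^ #(Finset.univ.filter fun j : Fin 4 => sd j ∈ T) := by
      simp only [kcSign]
      rw [prod_ite, prod_const, prod_const_one, mul_one]
    rw [Fin.prod_univ_four] at hp
    rw [hp]
    exact Odd.neg_one_pow hodd
  unfold kcModLaplacian
  rw [Fin.sum_univ_four, hside, hside, hside, hside]
  have e3 : (3 : Fin 4) + 1 = 0 := rfl
  simp only [show (0 : Fin 4) + 1 = 1 from rfl, show (1 : Fin 4) + 1 = 2 from rfl,
    show (2 : Fin 4) + 1 = 3 from rfl, e3]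
  have core := kc_laplacian_core (X T (v 0)) (X T (v 3)) (X T (v 2)) (X T (v 1))
    (kcSign T (sd 0)) (kcSign T (sd 3)) (kcSign T (sd 2)) (kcSign T (sd 1))
    (kcSign_eq_one_or T _) (kcSign_eq_one_or T _) (kcSign_eq_one_or T _) (kcSign_eq_one_or T _)
    (by linear_combination hprod)
  have q₀ := kcSign_mul_self T (sd 0)
  have q₁ := kcSign_mul_self T (sd 1)
  have q₂ := kcSign_mul_self T (sd 2)
  have q₃ := kcSign_mul_self T (sd 3)
  have hs : Real.sqrt 2 ^ 2 = 2 := Real.sq_sqrt zero_le_two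
  refine ⟨Real.sqrt 2 * kcSign T (sd 3) * X T (v 3) - X T (v 0) - kcSign T (sd 3) * kcSign T (sd 2) * X T (v 2),
    Real.sqrt 2 * kcSign T (sd 3) * kcSign T (sd 2) * kcSign T (sd 1) * X T (v 1) + X T (v 0) -
      kcSign T (sd 3) * kcSign T (sd 2) * X T (v 2), ?_⟩
  linear_combination -core + (X T (v 1) ^ 2) * q₀ + (X T (v 2) ^ 2) * q₁ + (X T (v 3) ^ 2) * q₂ +
    (X T (v 0) ^ 2) * q₃ + (X T (v 0) ^ 2 + X T (v 1) ^ 2 + X T (v 2) ^ 2 + X T (v 3) ^ 2) * hs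

/-- `kcModLaplacian ≥ 0` at such plaquettes (the modified superharmonicity of `H•` in the convention
of Chelkak–Hongler–Izyurov 2015, Prop. 3.6). [cite: ChelkakHonglerIzyurovAnnals2015, Prop. 3.6] -/
theorem IsKCPrimitive.kcModLaplacian_nonneg {Λ : Finset (Site 2)} {η : SpinConfig (Site 2)}
    (hη : ∀ v w : Site 2, spinAt v η = spinAt w η) {B : Finset (Site 2)}
    {cut : Site 2 → Finset (Sym2 (Site 2))} {Hw Hb : Site 2 → ℝ} {P : Set (Site 2)}
    (h : IsKCPrimitive G₂ Λ criticalBetaTwo (.fixed η) B cut Hw Hb P) (hc : IsKCCuts G₂ Λ cut P)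
    {f : Site 2} (hf : f ∈ P)
    (hP : ∀ j : Fin 4, (f + cornerOff j ∈ Λ ∨ f + cornerOff j + cornerUnit j ∈ Λ) → f + cornerUnit (j + 3) ∈ P)
    (hodd : Odd #(Finset.univ.filter fun j : Fin 4 =>
      s(f + cornerOff j, f + cornerOff j + cornerUnit j) ∈ cut f)) :
    0 ≤ kcModLaplacian Λ Hw Hb f := by
  obtain ⟨P₁, Q₁, hPQ⟩ := h.kcModLaplacian_eq G₂ hη hc hf hP hodd
  rw [hPQ]; positivity

end BoundaryMod

/-! ### Assembly on a general discrete domain: plaquettes touching the free sites, holes filled -/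

/-- **The plaquettes touching `Λ`**: those having a corner in `Λ` (CHI15's `Int 𝒱•`, the vertices
incident to interior faces). [cite: ChelkakHonglerIzyurovAnnals2015, §2.1] -/
def touchPlaquettes (Λ : Finset (Site 2)) : Finset (Site 2) := Λ.biUnion fun v => Finset.univ.image (faceAt v)

/-- Membership in `touchPlaquettes`. [cite: ChelkakHonglerIzyurovAnnals2015, §2.1] -/
theorem mem_touchPlaquettes {Λ : Finset (Site 2)} {p : Site 2} :
    p ∈ touchPlaquettes Λ ↔ ∃ v ∈ Λ, ∃ k : Fin 4, faceAt v k = p := by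
  simp [touchPlaquettes]

/-- The plaquettes around a free site touch `Λ`. [cite: ChelkakHonglerIzyurovAnnals2015, §2.1] -/
theorem faceAt_mem_touchPlaquettes {Λ : Finset (Site 2)} {v : Site 2} (hv : v ∈ Λ) (k : Fin 4) :
    faceAt v k ∈ touchPlaquettes Λ :=
  mem_touchPlaquettes.2 ⟨v, hv, k, rfl⟩

/-- If a bond touches `Λ`, both its plaquettes touch `Λ`. [cite: ChelkakHonglerIzyurovAnnals2015, §2.1] -/
theorem faceAt_mem_touchPlaquettes_of_endpoint {Λ : Finset (Site 2)} {u : Site 2} {k : Fin 4}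
    (h : u ∈ Λ ∨ u + cornerUnit k ∈ Λ) : faceAt u k ∈ touchPlaquettes Λ ∧ faceAt u (k + 3) ∈ touchPlaquettes Λ := by
  rcases h with h | h
  · exact ⟨faceAt_mem_touchPlaquettes h k, faceAt_mem_touchPlaquettes h (k + 3)⟩
  · constructor
    · rw [← faceAt_add_unit_succ]; exact faceAt_mem_touchPlaquettes h (k + 1)
    · rw [← faceAt_add_unit_add_two]; exact faceAt_mem_touchPlaquettes h (k + 2)

/-- **An admissible system of cuts extends trivially to the filled holes**: the filled-in plaquettes
have no corner in `Λ`, so every new interior bond is frozen. [cite: ChelkakHonglerIzyurovAnnals2015, §2.1] -/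
theorem IsKCCuts.fill {Λ : Finset (Site 2)} {cut : Site 2 → Finset (Sym2 (Site 2))}
    (h : IsKCCuts G₂ Λ cut ↑(touchPlaquettes Λ)) (hsub : ∀ p, cut p ⊆ edgesTouching G₂ Λ) :
    IsKCCuts G₂ Λ cut ↑(fillFinset (touchPlaquettes Λ)) := by
  refine ⟨fun p _ => hsub p, fun u k hk hk3 => ?_⟩
  by_cases hend : u ∈ Λ ∨ u + cornerUnit k ∈ Λ
  · obtain ⟨h1, h2⟩ := faceAt_mem_touchPlaquettes_of_endpoint hend
    exact h.step u k h1 h2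
  · exact Or.inr (not_or.1 hend)

/-- At a free site, the edge boundary of the singleton in the domain graph is the set of its four
lattice bonds. [folklore] -/
theorem edgeBoundary_singleton_eq {Λ : Finset (Site 2)} (hG : ∀ v ∈ Λ, ∀ k : Fin 4, G₂.Adj v (v + cornerUnit k))
    (hle : G₂ ≤ zdGraph 2) {u : Site 2} (hu : u ∈ Λ) :
    edgeBoundary G₂ {u} = Finset.univ.image fun k : Fin 4 => cSrc (u, k) := by
  ext b
  induction b using Sym2.ind with
  | _ a c =>
    rw [mk_mem_edgeBoundary_iff, Finset.mem_image]
    simp only [Finset.mem_singleton, Finset.mem_univ, true_and, cSrc]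
    constructor
    · rintro ⟨hadj, hac⟩
      by_cases ha : a = u
      · subst ha
        obtain ⟨k, rfl⟩ := exists_eq_add_cornerUnit (hle hadj)
        exact ⟨k, rfl⟩
      · have hc : c = u := by by_contra hc; exact ha (hac.2 hc)
        subst hc
        obtain ⟨k, rfl⟩ := exists_eq_add_cornerUnit (hle hadj).symm
        exact ⟨k, Sym2.eq_swap⟩
    · rintro ⟨k, hk⟩
      rw [Sym2.eq_iff] at hk
      have hne : ¬ u + cornerUnit k = u := fun h' => cornerUnit_ne_zero k (by simpa using h')
      rcases hk with ⟨rfl, rfl⟩ | ⟨rfl, rfl⟩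
      · exact ⟨hG u hu k, ⟨fun _ => hne, fun _ => rfl⟩⟩
      · exact ⟨(hG u hu k).symm, ⟨fun h => absurd h hne, fun h => absurd rfl h⟩⟩

end CutExistence

/-! ### The Kadanoff–Ceva primitive on a general discrete domain -/

section Assembly

open SimpleGraph

variable (G₂ : SimpleGraph (Site 2)) [G₂.LocallyFinite]

/-- **The discrete primitive of the critical Kadanoff–Ceva fermion exists on every hole-free,
usably connected discrete domain, with an admissible system of cuts emanating from the source
plaquette** (Chelkak–Hongler–Izyurov 2015, Prop. 3.6 (i), without the no-fjord assumption of §2.1;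
the set of plaquettes is `Int 𝒱•` with its holes filled). [cite: ChelkakHonglerIzyurovAnnals2015, Prop. 3.6 and §2.1] -/
theorem exists_kcCuts_primitive {Λ : Finset (Site 2)} (hG : ∀ v ∈ Λ, ∀ k : Fin 4, G₂.Adj v (v + cornerUnit k))
    (hle : G₂ ≤ zdGraph 2) (hΛ : HoleFree (↑Λ : Set (Site 2))) {p₀ : Site 2}
    (hconn : ∀ p ∈ touchPlaquettes Λ, ∃ W : (zdGraph 2).Walk p₀ p, UsableWalk Λ W)
    (β : ℝ) (η : SpinConfig (Site 2)) (B : Finset (Site 2)) :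
    ∃ (cut : Site 2 → Finset (Sym2 (Site 2))) (Hw Hb : Site 2 → ℝ),
      IsKCCuts G₂ Λ cut ↑(fillFinset (touchPlaquettes Λ)) ∧ cut p₀ = ∅ ∧
      (∀ p ∈ touchPlaquettes Λ, p ≠ p₀ → Odd #(Finset.univ.filter fun j : Fin 4 => plaqSide p j ∈ cut p)) ∧
      IsKCPrimitive G₂ Λ β (.fixed η) B cut Hw Hb ↑(fillFinset (touchPlaquettes Λ)) := by
  obtain ⟨cut, hcuts, h0, hodd, hsub⟩ := exists_isKCCuts G₂ hG hle hΛ (P := ↑(touchPlaquettes Λ)) hconn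
  have hfill : IsKCCuts G₂ Λ cut ↑(fillFinset (touchPlaquettes Λ)) := hcuts.fill G₂ hsub
  obtain ⟨Hw, Hb, hprim⟩ := hfill.exists_isKCPrimitive G₂ β η B (holeFree_fillFinset _)
  exact ⟨cut, Hw, Hb, hfill, h0, fun p hp => hodd p hp, hprim⟩

/-- **Superharmonicity of the critical primitive at the free sites off the background spins**, on a
general discrete domain (Chelkak–Hongler–Izyurov 2015, Prop. 3.6 (iv): "`H°` is `Δ°`-subharmonic on
`𝒱° ∖ {a, a₁, …}`", in their sign convention), for any primitive of any admissible cut system on the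
filled set of plaquettes touching `Λ`. [cite: ChelkakHonglerIzyurovAnnals2015, Prop. 3.6] -/
theorem IsKCPrimitive.latticeLaplacian_white_nonpos_of_mem {Λ : Finset (Site 2)}
    (hG : ∀ v ∈ Λ, ∀ k : Fin 4, G₂.Adj v (v + cornerUnit k)) (hle : G₂ ≤ zdGraph 2)
    {η : SpinConfig (Site 2)} {B : Finset (Site 2)} {cut : Site 2 → Finset (Sym2 (Site 2))} {Hw Hb : Site 2 → ℝ}
    (h : IsKCPrimitive G₂ Λ criticalBetaTwo (.fixed η) B cut Hw Hb ↑(fillFinset (touchPlaquettes Λ)))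
    (hc : IsKCCuts G₂ Λ cut ↑(fillFinset (touchPlaquettes Λ))) {u : Site 2} (hu : u ∈ Λ) (huB : u ∉ B) :
    latticeLaplacian Hw u ≤ 0 :=
  h.latticeLaplacian_white_nonpos hc hu huB
    (fun k => Finset.mem_coe.2 (subset_fillFinset _ (faceAt_mem_touchPlaquettes hu k)))
    (edgeBoundary_singleton_eq G₂ hG hle hu)

/-- `Hw ≤ Hb` across every corner of the system (the fluxes are squares): the premise
"`H°(w) ≥ H•(v)` for adjacent `w` and `v`" of the maximum principle of Chelkak–Hongler–Izyurov
2015, Remark 3.7, in the tree's orientation. [cite: ChelkakHonglerIzyurovAnnals2015, Remark 3.7] -/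
theorem IsKCPrimitive.hw_le_hb {Λ : Finset (Site 2)} {β : ℝ} {bc : BoundaryCondition (Site 2)}
    {B : Finset (Site 2)} {cut : Site 2 → Finset (Sym2 (Site 2))} {Hw Hb : Site 2 → ℝ} {P : Set (Site 2)}
    (h : IsKCPrimitive G₂ Λ β bc B cut Hw Hb P) {v : Site 2} {k : Fin 4} (hk : faceAt v k ∈ P) :
    Hw v ≤ Hb (faceAt v k) := by
  have e := h (v, k) (by simpa [faceSetCorners, cFace] using hk)
  simp only [cFace, kcFlux] at e
  nlinarith [sq_nonneg (kcCorner G₂ Λ β bc B (cut (faceAt v k)) v)]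

/-! ### Specialisation to the discrete domains of a planar domain -/

/-- A free site of the discrete domain `Ω_δ` (a site of `meshInteriorFinset Ω δ`) is joined in
`Ω_δ` to its four lattice neighbours (this is the definition of the discrete boundary
`meshBoundary`). [cite: ChelkakHonglerIzyurovAnnals2015, §1.2] -/
theorem discreteDomainGraph_adj_of_mem_meshInteriorFinset {Ω : Set ℂ} {δ : ℝ} {v : Site 2}
    (hv : v ∈ meshInteriorFinset Ω δ) (k : Fin 4) : (discreteDomainGraph Ω δ).Adj v (v + cornerUnit k) := by
  classical
  unfold meshInteriorFinset at hv
  split_ifs at hv with h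
  · rw [Finset.mem_filter, Set.Finite.mem_toFinset] at hv
    obtain ⟨hvD, hvB⟩ := hv
    by_contra hadj
    exact hvB ⟨hvD, v + cornerUnit k, cSrc_mem_edgeSet (v, k), hadj⟩
  · simp at hv

/-- `Ω_δ` is a subgraph of `ℤ²`. [cite: ChelkakHonglerIzyurovAnnals2015, §1.2] -/
theorem discreteDomainGraph_le_zdGraph (Ω : Set ℂ) (δ : ℝ) : discreteDomainGraph Ω δ ≤ zdGraph 2 :=
  (discreteDomainGraph_le_meshGraph Ω δ).trans (meshGraph_le_zdGraph Ω δ)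

/-- **The critical Kadanoff–Ceva primitive on the discrete domains `Ω_δ` of CHI** (`+` boundary
condition on `∂Ω_δ`, free spins on `meshInteriorFinset Ω δ`, graph `discreteDomainGraph Ω δ` — the
objects of `meshIsingPlusCorr`): if the free sites are hole-free as cells and the plaquettes touching
them are usably reachable from the source plaquette `p₀`, there are an admissible cut system from
`p₀` on the filled set of plaquettes and a primitive pair, with `Δ Hw ≤ 0` at every free site off
`B`, the boundary-modified `Δ• Hb ≥ 0` at every plaquette touching the free sites other than `p₀`,
and `Hw` constant along frozen bonds (Chelkak–Hongler–Izyurov 2015, Prop. 3.6 (i), (iv) and the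
Dirichlet part of (ii), in Kadanoff–Ceva form). [cite: ChelkakHonglerIzyurovAnnals2015, Prop. 3.6] -/
theorem exists_kcCuts_primitive_mesh (Ω : Set ℂ) (δ : ℝ) (hΛ : HoleFree (↑(meshInteriorFinset Ω δ) : Set (Site 2)))
    {p₀ : Site 2}
    (hconn : ∀ p ∈ touchPlaquettes (meshInteriorFinset Ω δ), ∃ W : (zdGraph 2).Walk p₀ p,
      UsableWalk (meshInteriorFinset Ω δ) W)
    (β : ℝ) (B : Finset (Site 2)) :
    ∃ (cut : Site 2 → Finset (Sym2 (Site 2))) (Hw Hb : Site 2 → ℝ),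
      IsKCCuts (discreteDomainGraph Ω δ) (meshInteriorFinset Ω δ) cut
          ↑(fillFinset (touchPlaquettes (meshInteriorFinset Ω δ))) ∧ cut p₀ = ∅ ∧
      (∀ p ∈ touchPlaquettes (meshInteriorFinset Ω δ), p ≠ p₀ →
        Odd #(Finset.univ.filter fun j : Fin 4 => plaqSide p j ∈ cut p)) ∧
      IsKCPrimitive (discreteDomainGraph Ω δ) (meshInteriorFinset Ω δ) β .plus B cut Hw Hb
          ↑(fillFinset (touchPlaquettes (meshInteriorFinset Ω δ))) :=
  exists_kcCuts_primitive (discreteDomainGraph Ω δ)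
    (fun _ hv k => discreteDomainGraph_adj_of_mem_meshInteriorFinset hv k)
    (discreteDomainGraph_le_zdGraph Ω δ) hΛ hconn β 1 B

/-- On `Ω_δ`: `Δ Hw ≤ 0` at every free site off the background spins (critical `β`).
[cite: ChelkakHonglerIzyurovAnnals2015, Prop. 3.6] -/
theorem IsKCPrimitive.latticeLaplacian_white_nonpos_mesh {Ω : Set ℂ} {δ : ℝ} {B : Finset (Site 2)}
    {cut : Site 2 → Finset (Sym2 (Site 2))} {Hw Hb : Site 2 → ℝ}
    (h : IsKCPrimitive (discreteDomainGraph Ω δ) (meshInteriorFinset Ω δ) criticalBetaTwo .plus B cut Hw Hb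
      ↑(fillFinset (touchPlaquettes (meshInteriorFinset Ω δ))))
    (hc : IsKCCuts (discreteDomainGraph Ω δ) (meshInteriorFinset Ω δ) cut
      ↑(fillFinset (touchPlaquettes (meshInteriorFinset Ω δ))))
    {u : Site 2} (hu : u ∈ meshInteriorFinset Ω δ) (huB : u ∉ B) : latticeLaplacian Hw u ≤ 0 :=
  h.latticeLaplacian_white_nonpos_of_mem (discreteDomainGraph Ω δ)
    (fun _ hv k => discreteDomainGraph_adj_of_mem_meshInteriorFinset hv k)
    (discreteDomainGraph_le_zdGraph Ω δ) hc hu huB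

/-- On `Ω_δ`: the boundary-modified `Δ• Hb ≥ 0` at every plaquette touching the free sites whose cut
contains an odd number of its sides (every such plaquette other than the source, for the cut
systems of `exists_kcCuts_primitive_mesh`). [cite: ChelkakHonglerIzyurovAnnals2015, Prop. 3.6] -/
theorem IsKCPrimitive.kcModLaplacian_nonneg_mesh {Ω : Set ℂ} {δ : ℝ} {B : Finset (Site 2)}
    {cut : Site 2 → Finset (Sym2 (Site 2))} {Hw Hb : Site 2 → ℝ}
    (h : IsKCPrimitive (discreteDomainGraph Ω δ) (meshInteriorFinset Ω δ) criticalBetaTwo .plus B cut Hw Hb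
      ↑(fillFinset (touchPlaquettes (meshInteriorFinset Ω δ))))
    (hc : IsKCCuts (discreteDomainGraph Ω δ) (meshInteriorFinset Ω δ) cut
      ↑(fillFinset (touchPlaquettes (meshInteriorFinset Ω δ))))
    {f : Site 2} (hf : f ∈ touchPlaquettes (meshInteriorFinset Ω δ))
    (hodd : Odd #(Finset.univ.filter fun j : Fin 4 => plaqSide f j ∈ cut f)) :
    0 ≤ kcModLaplacian (meshInteriorFinset Ω δ) Hw Hb f := by
  refine h.kcModLaplacian_nonneg (discreteDomainGraph Ω δ) (fun v w => by simp [spinAt]) hc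
    (Finset.mem_coe.2 (subset_fillFinset _ hf)) (fun j hj => ?_) hodd
  -- the plaquette beyond a side touching `Λ` touches `Λ`
  have h2 : faceAt (f + cornerOff j) (j + 3) = f + cornerUnit (j + 3) := faceAt_face_corner_add_three f j
  rw [← h2]
  exact Finset.mem_coe.2 (subset_fillFinset _ (faceAt_mem_touchPlaquettes_of_endpoint hj).2)

end Assembly


end Literature.Probability.LatticeModels
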